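import Summits.ValiantsHypothesis.ValiantsHypothesis.Theorems.TwoProducts.RankThreeAffineWronskianLadder
import Summits.ValiantsHypothesis.ValiantsHypothesis.Theorems.TwoProducts.RankThreeAffineFewnomial

/-!
# Rank three AFFINE, T1-E′: `nv (P(w₀,w₁,w₂)) ≤ (t+2)^(16·r² + 10)` for `P` with `≤ r` monomials — the fewnomial law with exponent QUADRATIC in `r`

Instance + law of the WRONSKIAN LADDER ✓ `card_Eset_unitSumW_le` (`…RankThreeAffineWronskianLadder`) on the located class «bounded fewnomials» of the
OPEN rung 3-AFF of the SIDE ladder «table-rank-ladder» of crux `stmt-ValiantsHypothesis-5906` (`TwoProducts`) — val-port-1 g5; val-idea-crit-8 g5 #87 (S3).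
Units `w₀^a w₁^b w₂^d` (✓ `bracket_identity3`, `card_support_bracket3_le`, `card_Eset_unit3_le`, `aeval_eq_unitSum`, `fixZero` of `…RankThreeAffineFewnomial`),
`M = w₀w₁w₂` (`μ = t³`), numerators `≤ 3t⁴` terms, `η = 3t²`.
RESULTS: `card_Eset_monomialSumW_le`, ★ `card_Eset_fewnomialW_le : |Eset σ (P(w))| ≤ flagBound t (wEB t t³ (3t⁴) (3t²)) 0 r`, ★★ `fewnomialAffine_nv_le' :
nv (P(w)) ≤ fewBoundW r t` (`|supp P| ≤ r`, `t`-sparse carriers, nothing else assumed), `flagBound_le` (closed form `n·(3(t²+t) + 4·B(i+n) + 2)` for monotone `B`),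
`wEB_le_pow : wEB t t³ (3t⁴) (3t²) r ≤ (t+2)^(14·r·r + r + 5)`, ★ `fewBoundW_le_pow : fewBoundW r t ≤ (t+2)^(14·r·r + 2·r + 10)`, and the law
★★ `fewnomialAffineLawQuad : FewnomialAffineLawQuad` — `∃ c₀ c₁ ∀ r t P w, nv ≤ (t+2)^(c₀·r·r + c₁)` with `(c₀, c₁) = (16, 10)` — versus ✓ `FewnomialAffineLaw`
(`∀ r ∃ c`, `c = 8·ladderExp r + 3`, `ladderExp r ≍ 6^r`).
PRINT COMPARATOR: the exponent quadratic in `r` is the Newton-polygon shadow, at `m = 3` carriers, of Koiran–Portier–Tavenas, *A Wronskian approach to the real τ-conjecture*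
(J. Symb. Comput. 2015; arXiv 1205.1015 p. 3: the number of real roots of `Σ_{i≤k} Π_{j≤m} f_j^{α_ij}` with `t`-sparse `f_j` is `≤ t^{O(k²m)}`), obtained by the same Wronskian /
flag method in the `Eset` / unit-derivation currency [cite: KoiranPortierTavenas2015, Thm 1] — novelty VARIANT; NOT polynomial in `(m,t)` for free `r ≤ C(m+3,3)`.
HONEST LABEL: located class on an OPEN rung; `r`-UNIFORMITY is NOT claimed (the exponent still grows, like `r²`); nothing here closes 5906 /
`RankThreeAffineLaw` / `OLMLaw` / `PlanarCellBound` / `ResidualLawV25`; `TwoProducts` OPEN; VP ≠ VNP is NOT proved here or anywhere in this tree.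
`--supports stmt-ValiantsHypothesis-5906 --as helper`.  No instances, no notation, no named facts. [folklore]
-/

noncomputable section
set_option linter.dupNamespace false

namespace Summit.ValiantsHypothesis.ValiantsHypothesis.Theorems.TwoProducts.RankTwoJacobian

open scoped BigOperators Pointwise Classical
open MvPolynomial
open Literature.LinearAlgebra.Matrix (wronskian)
open Summit.ValiantsHypothesis.ValiantsHypothesis.Theorems.TwoProducts.Wronskian

/-! ### §5 The fewnomial instance (T1-E′) -/

/-- **Per chart, nonzero carriers, one of them non-constant:** `|Eset σ (Σ_{α∈K} w^α·C(c α))| ≤ flagBound t (wEB t t³ (3t⁴) (3t²)) 0 |K|`. -/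
theorem card_Eset_monomialSumW_le {σ : ℝ} (hσ : σ = 1 ∨ σ = -1) {t r : ℕ} (w : Fin 3 → Poly2)
    (hw : ∀ i, (w i).support.card ≤ t) (hw0 : ∀ i, w i ≠ 0) {i₀ : Fin 3} (hv : (S1 (w i₀)).Nonempty)
    (K : Finset (Fin 3 →₀ ℕ)) (c : (Fin 3 →₀ ℕ) → ℂ) (hK : K.card ≤ r) :
    (Eset σ (∑ α ∈ K, (w 0 ^ α 0 * w 1 ^ α 1 * w 2 ^ α 2) * C (c α))).card ≤
      flagBound t (wEB t (t ^ 3) (3 * t ^ 4) (3 * (t * t))) 0 r := by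
  have hM : w 0 * w 1 * w 2 ≠ 0 := mul_ne_zero (mul_ne_zero (hw0 0) (hw0 1)) (hw0 2)
  have hμ : (w 0 * w 1 * w 2).support.card ≤ t ^ 3 := by
    have := (card_supp_mul_le (w 0 * w 1) (w 2)).trans (Nat.mul_le_mul ((card_supp_mul_le (w 0) (w 1)).trans (Nat.mul_le_mul (hw 0) (hw 1))) (hw 2))
    have e : t * t * t = t ^ 3 := by ring
    omega
  exact card_Eset_unitSumW_le hσ hv (hw i₀) hM hμ
    (fun α : Fin 3 →₀ ℕ => w 0 ^ α 0 * w 1 ^ α 1 * w 2 ^ α 2)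
    (fun α : Fin 3 →₀ ℕ => C ((α 0 : ℕ) : ℂ) * (w 1 * w 2 * jac (w 0) (w i₀)) + C ((α 1 : ℕ) : ℂ) * (w 0 * w 2 * jac (w 1) (w i₀)) +
      C ((α 2 : ℕ) : ℂ) * (w 0 * w 1 * jac (w 2) (w i₀)))
    (fun α => bracket_identity3 (w 0) (w 1) (w 2) (w i₀) (α 0) (α 1) (α 2))
    (fun α => card_support_bracket3_le (w 0) (w 1) (w 2) (w i₀) (hw 0) (hw 1) (hw 2) (hw i₀) (α 0) (α 1) (α 2))
    (fun α => card_Eset_unit3_le hσ (w 0) (w 1) (w 2) (hw 0) (hw 1) (hw 2) (hw0 0) (hw0 1) (hw0 2) (α 0) (α 1) (α 2))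
    K (fun α => C (c α)) (fun α _ => jac_C_left (c α) (w i₀)) hK

/-- ★ **Per chart:** for `P : ℂ[X₀,X₁,X₂]` with `≤ r` monomials and `t`-sparse carriers (no other hypothesis),
`|Eset σ (P(w))| ≤ flagBound t (wEB t t³ (3t⁴) (3t²)) 0 r`. -/
theorem card_Eset_fewnomialW_le {σ : ℝ} (hσ : σ = 1 ∨ σ = -1) {r t : ℕ} (P : Poly3) (hP : P.support.card ≤ r)
    (w : Fin 3 → Poly2) (hw : ∀ i, (w i).support.card ≤ t) :
    (Eset σ (MvPolynomial.aeval w P)).card ≤ flagBound t (wEB t (t ^ 3) (3 * t ^ 4) (3 * (t * t))) 0 r := by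
  rw [aeval_eq_unitSum]
  set K := P.support.filter (fun α => ∀ i, w i = 0 → α i = 0) with hK
  have hKr : K.card ≤ r := (Finset.card_filter_le _ _).trans hP
  by_cases hnc : ∃ i, (S1 (fixZero w i)).Nonempty
  · obtain ⟨i₀, hi₀⟩ := hnc
    have ht : 1 ≤ t := by
      obtain ⟨s, hs⟩ := hi₀
      have hs' := (mem_S1.mp hs).1
      have hne : fixZero w i₀ = w i₀ := by
        unfold fixZero; split_ifs with hz
        · exfalso
          unfold fixZero at hs'; rw [if_pos hz, MvPolynomial.support_one, Finset.mem_singleton] at hs'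
          exact (mem_S1.mp hs).2 hs'
        · rfl
      rw [hne] at hs'
      exact le_trans (Finset.card_pos.mpr ⟨s, hs'⟩) (hw i₀)
    exact card_Eset_monomialSumW_le hσ (fixZero w) (card_support_fixZero_le w hw ht) (fixZero_ne_zero w) hi₀ K
      (fun α => coeff α P) hKr
  · have hnc' : ∀ i, ¬ (S1 (fixZero w i)).Nonempty := fun i h => hnc ⟨i, h⟩
    obtain ⟨c, hc⟩ : ∃ c : Fin 3 → ℂ, ∀ i, fixZero w i = C (c i) :=
      ⟨fun i => coeff 0 (fixZero w i), fun i => eq_C_of_S1_empty (hnc' i)⟩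
    have hsum : ∑ α ∈ K, (fixZero w 0 ^ α 0 * fixZero w 1 ^ α 1 * fixZero w 2 ^ α 2) * C (coeff α P) =
        C (∑ α ∈ K, (c 0 ^ α 0 * c 1 ^ α 1 * c 2 ^ α 2) * coeff α P) := by
      rw [map_sum]
      refine Finset.sum_congr rfl fun α _ => ?_
      rw [hc 0, hc 1, hc 2, ← map_pow, ← map_pow, ← map_pow, ← map_mul, ← map_mul, ← map_mul]
    rw [hsum, Eset_C]
    simp

/-- THE WRONSKIAN-LADDER FEWNOMIAL BOUND `2·flagBound t (wEB t t³ (3t⁴) (3t²)) 0 r + 4` (explicit, primitive recursive; `≤ (t+2)^(14·r·r + 2·r + 10)`). -/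
def fewBoundW (r t : ℕ) : ℕ := 2 * flagBound t (wEB t (t ^ 3) (3 * t ^ 4) (3 * (t * t))) 0 r + 4

/-- ★★ **T1-E′.** For every `P ∈ ℂ[X₀,X₁,X₂]` with at most `r` monomials and `t`-sparse carriers `w₀, w₁, w₂ ∈ ℂ[x,y]`:
`nv (P(w₀,w₁,w₂)) ≤ fewBoundW r t ≤ (t+2)^(14·r² + 2·r + 10)` (`fewBoundW_le_pow`). -/
theorem fewnomialAffine_nv_le' (r t : ℕ) (P : Poly3) (hP : P.support.card ≤ r) (w : Fin 3 → Poly2)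
    (hw : ∀ i, (w i).support.card ≤ t) : nv (MvPolynomial.aeval w P) ≤ fewBoundW r t := by
  have h1 := card_Eset_fewnomialW_le (σ := 1) (Or.inl rfl) P hP w hw
  have h2 := card_Eset_fewnomialW_le (σ := -1) (Or.inr rfl) P hP w hw
  have h := nv_le (MvPolynomial.aeval w P)
  unfold fewBoundW
  omega

/-! ### §6 The law: exponent quadratic in `r` -/

/-- `wEB` is monotone in the flag length. [folklore] -/
theorem wEB_mono (t μ ℓ η : ℕ) {i j : ℕ} (h : i ≤ j) : wEB t μ ℓ η i ≤ wEB t μ ℓ η j := by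
  unfold wEB
  have h1 : i * η ≤ j * η := Nat.mul_le_mul_right η h
  have h2 : i.factorial * (ℓ + μ * t + 1) ^ (i * i) ≤ j.factorial * (ℓ + μ * t + 1) ^ (j * j) :=
    Nat.mul_le_mul (Nat.factorial_le h) (Nat.pow_le_pow_right (Nat.succ_pos _) (Nat.mul_le_mul h h))
  exact Nat.add_le_add h1 (Nat.pow_le_pow_left h2 2)

/-- **Closed form:** `flagBound t B i n ≤ n·(3(t²+t) + 4·B(i+n) + 2)` for monotone `B`. [folklore] -/
theorem flagBound_le (t : ℕ) {B : ℕ → ℕ} (hB : ∀ i j, i ≤ j → B i ≤ B j) :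
    ∀ (n i : ℕ), flagBound t B i n ≤ n * (3 * (t * t + t) + 4 * B (i + n) + 2)
  | 0, i => by simp [flagBound]
  | n + 1, i => by
    show 3 * (t * t + t) + 3 * B (i + 1) + B i + 2 + flagBound t B (i + 1) n ≤ _
    have ih := flagBound_le t hB n (i + 1)
    rw [Nat.add_right_comm i 1 n] at ih
    have h1 := hB _ _ (show i + 1 ≤ i + (n + 1) by omega)
    have h0 := hB _ _ (show i ≤ i + (n + 1) by omega)
    rw [add_one_mul]
    have e : i + n + 1 = i + (n + 1) := rfl
    rw [e] at ih
    omega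

/-- Arithmetic of the base `X = t + 2`: `(t+2)^4 = t^4 + 8t³ + 24t² + 32t + 16`. [folklore] -/
theorem base_pow_four (t : ℕ) : (t + 2) ^ 4 = t ^ 4 + 8 * t ^ 3 + 24 * (t * t) + 32 * t + 16 := by ring

/-- `2·X^a ≤ X^b` for `X = t+2` and `a < b`. [folklore] -/
theorem two_mul_pow_le (t : ℕ) {a b : ℕ} (hab : a < b) : 2 * (t + 2) ^ a ≤ (t + 2) ^ b := by
  calc 2 * (t + 2) ^ a ≤ (t + 2) * (t + 2) ^ a := Nat.mul_le_mul_right _ (by omega)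
    _ = (t + 2) ^ (a + 1) := by rw [pow_succ, mul_comm]
    _ ≤ (t + 2) ^ b := Nat.pow_le_pow_right (by omega) hab

/-- ★ **Power form of the flag-Wronskian edge bound** (fewnomial parameters): `wEB t t³ (3t⁴) (3t²) r ≤ (t+2)^(14·r·r + r + 5)`. [folklore] -/
theorem wEB_le_pow (t r : ℕ) : wEB t (t ^ 3) (3 * t ^ 4) (3 * (t * t)) r ≤ (t + 2) ^ (14 * r * r + r + 5) := by
  have hX : 1 < t + 2 := by omega
  have hX1 : 0 < t + 2 := by omega
  have h4 := base_pow_four t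
  -- `θ + 1 = 4t⁴ + 1 ≤ X^6`
  have hθ : 3 * t ^ 4 + t ^ 3 * t + 1 ≤ (t + 2) ^ 6 := by
    have e3 : t ^ 3 * t = t ^ 4 := by ring
    have e6 : (t + 2) ^ 6 = (t + 2) * (t + 2) * (t + 2) ^ 4 := by ring
    have h22 : 4 ≤ (t + 2) * (t + 2) := by nlinarith
    rw [e3, e6, h4]
    calc 3 * t ^ 4 + t ^ 4 + 1 ≤ 4 * (t ^ 4 + 8 * t ^ 3 + 24 * (t * t) + 32 * t + 16) := by omega
      _ ≤ (t + 2) * (t + 2) * (t ^ 4 + 8 * t ^ 3 + 24 * (t * t) + 32 * t + 16) := Nat.mul_le_mul_right _ h22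
  -- `η = 3t² ≤ X^4`
  have hη : 3 * (t * t) ≤ (t + 2) ^ 4 := by rw [h4]; omega
  -- `r ≤ X^r`, `r! ≤ X^(r·r)`
  have hr : r ≤ (t + 2) ^ r := (Nat.lt_pow_self hX).le
  have hfact : r.factorial ≤ (t + 2) ^ (r * r) := by
    rw [pow_mul]
    exact (Nat.factorial_le_pow r).trans (Nat.pow_le_pow_left hr r)
  have hpow : (3 * t ^ 4 + t ^ 3 * t + 1) ^ (r * r) ≤ (t + 2) ^ (6 * (r * r)) :=
    (Nat.pow_le_pow_left hθ (r * r)).trans (pow_mul (t + 2) 6 (r * r)).symm.le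
  have hprod : r.factorial * (3 * t ^ 4 + t ^ 3 * t + 1) ^ (r * r) ≤ (t + 2) ^ (7 * (r * r)) := by
    have := Nat.mul_le_mul hfact hpow
    rw [← pow_add] at this
    have e : r * r + 6 * (r * r) = 7 * (r * r) := by ring
    rwa [e] at this
  have hsq : (r.factorial * (3 * t ^ 4 + t ^ 3 * t + 1) ^ (r * r)) ^ 2 ≤ (t + 2) ^ (14 * r * r) := by
    have := Nat.pow_le_pow_left hprod 2
    rw [← pow_mul] at this
    have e : 7 * (r * r) * 2 = 14 * r * r := by ring
    rwa [e] at this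
  have hlin : r * (3 * (t * t)) ≤ (t + 2) ^ (r + 4) := by
    rw [pow_add]
    exact Nat.mul_le_mul hr hη
  unfold wEB
  have hA : (t + 2) ^ (r + 4) ≤ (t + 2) ^ (14 * r * r + r + 4) := Nat.pow_le_pow_right hX1 (by omega)
  have hB : (t + 2) ^ (14 * r * r) ≤ (t + 2) ^ (14 * r * r + r + 4) := Nat.pow_le_pow_right hX1 (by omega)
  have h2 := two_mul_pow_le t (show 14 * r * r + r + 4 < 14 * r * r + r + 5 by omega)
  omega

/-- ★ **Power form of T1-E′:** `fewBoundW r t ≤ (t+2)^(14·r·r + 2·r + 10)`. [folklore] -/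
theorem fewBoundW_le_pow (r t : ℕ) : fewBoundW r t ≤ (t + 2) ^ (14 * r * r + 2 * r + 10) := by
  have hX1 : 0 < t + 2 := by omega
  have hX : 1 < t + 2 := by omega
  have hW := wEB_le_pow t r
  have hF := flagBound_le t (B := wEB t (t ^ 3) (3 * t ^ 4) (3 * (t * t))) (fun i j h => wEB_mono t (t ^ 3) (3 * t ^ 4) (3 * (t * t)) h) r 0
  rw [Nat.zero_add] at hF
  have h4 := base_pow_four t
  -- the step cost `S = 3(t²+t) + 4·wEB + 2 ≤ X^4 + X^(14rr+r+7) ≤ X^(14rr+r+8)`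
  have hS1 : 3 * (t * t + t) + 2 ≤ (t + 2) ^ 4 := by rw [h4]; nlinarith
  have hS2 : 4 * wEB t (t ^ 3) (3 * t ^ 4) (3 * (t * t)) r ≤ (t + 2) ^ (14 * r * r + r + 7) := by
    have h22 : 4 ≤ (t + 2) ^ 2 := by nlinarith
    calc 4 * wEB t (t ^ 3) (3 * t ^ 4) (3 * (t * t)) r ≤ (t + 2) ^ 2 * (t + 2) ^ (14 * r * r + r + 5) := Nat.mul_le_mul h22 hW
      _ = (t + 2) ^ (14 * r * r + r + 7) := by rw [← pow_add]; ring_nf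
  have hS : 3 * (t * t + t) + 4 * wEB t (t ^ 3) (3 * t ^ 4) (3 * (t * t)) r + 2 ≤ (t + 2) ^ (14 * r * r + r + 8) := by
    have hA : (t + 2) ^ 4 ≤ (t + 2) ^ (14 * r * r + r + 7) := Nat.pow_le_pow_right hX1 (by omega)
    have h2 := two_mul_pow_le t (show 14 * r * r + r + 7 < 14 * r * r + r + 8 by omega)
    omega
  have hr : r ≤ (t + 2) ^ r := (Nat.lt_pow_self hX).le
  have hRS : r * (3 * (t * t + t) + 4 * wEB t (t ^ 3) (3 * t ^ 4) (3 * (t * t)) r + 2) ≤ (t + 2) ^ (14 * r * r + 2 * r + 8) := by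
    calc _ ≤ (t + 2) ^ r * (t + 2) ^ (14 * r * r + r + 8) := Nat.mul_le_mul hr hS
      _ = (t + 2) ^ (14 * r * r + 2 * r + 8) := by rw [← pow_add]; ring_nf
  unfold fewBoundW
  have hE := hF.trans hRS
  have h2a := two_mul_pow_le t (show 14 * r * r + 2 * r + 8 < 14 * r * r + 2 * r + 9 by omega)
  have h4le : 4 ≤ (t + 2) ^ (14 * r * r + 2 * r + 9) :=
    le_trans (by nlinarith : 4 ≤ (t + 2) ^ 2) (Nat.pow_le_pow_right hX1 (by omega))
  have h2b := two_mul_pow_le t (show 14 * r * r + 2 * r + 9 < 14 * r * r + 2 * r + 10 by omega)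
  omega

/-- The BOUNDED-FEWNOMIAL affine law with exponent QUADRATIC in the number of monomials: absolute `c₀, c₁` with
`nv (P(w)) ≤ (t+2)^(c₀·r·r + c₁)` whenever `|supp P| ≤ r` and the carriers are `t`-sparse.  PROVED below (`fewnomialAffineLawQuad`, `(c₀, c₁) = (16, 10)`);
compare ✓ `FewnomialAffineLaw` (`∀ r ∃ c`, `c = 8·ladderExp r + 3` exponential in `r`). -/
def FewnomialAffineLawQuad : Prop :=
  ∃ c₀ c₁ : ℕ, ∀ (r t : ℕ) (P : Poly3) (w : Fin 3 → Poly2), P.support.card ≤ r → (∀ i, (w i).support.card ≤ t) →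
    nv (MvPolynomial.aeval w P) ≤ (t + 2) ^ (c₀ * r * r + c₁)

/-- ★★ **`FewnomialAffineLawQuad` holds** (`c₀ = 16`, `c₁ = 10`). -/
theorem fewnomialAffineLawQuad : FewnomialAffineLawQuad := by
  refine ⟨16, 10, fun r t P w hP hw => (fewnomialAffine_nv_le' r t P hP w hw).trans ((fewBoundW_le_pow r t).trans ?_)⟩
  have hr : r ≤ r * r := Nat.le_mul_self r
  exact Nat.pow_le_pow_right (by omega) (by nlinarith)

end Summit.ValiantsHypothesis.ValiantsHypothesis.Theorems.TwoProducts.RankTwoJacobian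

end
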